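import Mathlib
import Summits.RiemannHypothesis.RiemannHypothesis.Theses.RuelleBand
import Literature.NumberTheory.DiophantineGeometry.NamedHypothesesRHProofs
import Literature.NumberTheory.LFunctions.GeneralizedRH
import Literature.NumberTheory.LFunctions.ZetaRealAxis
import Literature.NumberTheory.LFunctions.ZetaZerosProofs

/-!
# Costume detectors, zero-location tails (cell `rh-split`, seat x-barrier g2) — RAW forms, zero definitions

HONEST LABEL: «SPLITTING SEARCH over kernel-typed RH-EQUIVALENCES; a splitting A ∧ B ⟹ RH is CONDITIONAL
bookkeeping unless A and B are both proved; nothing here bears on the truth of RH.»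

Raw (definition-free) forms of the load-bearing statements of `HOME/rh-split-x-barrier/SplitXBarrierG2.lean`, for the
typers' `Theorems/Splittings/CostumeDetectors*` batch. «Off-line» is spelled `0 < s.re ∧ s.re < 1 ∧ s.re ≠ 1/2`
throughout; a ZERO-LOCATION TAIL with exclusion region `R ⊆ ℂ` is «no off-line zero in `R`»; the finite part is the
tree's `RiemannHypothesisUpTo T` (zeros with `0 < im ≤ T` on the line).

* `forall_locusSplit_iff_cover` — COVERING CRITERION: «FIN(T) ∧ (no off-line point in R) ⟹ no off-line point» holds
  for EVERY set `Z ⊆ ℂ` iff `R` contains every off-line point of height `> T`. (A zero-location splitting closes by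
  bookkeeping iff its tail already contains «RH above T»; one uncovered point is a counter-model.)
* `not_forall_countSplit` — COUNT CURRENCY: «at most one off-line point» ∧ FIN(T) gives «no off-line point» for no
  bookkeeping reason, for every `T`.
* `exists_model_locus_infinite` — a region leaving off-line points of unbounded height uncovered admits an INFINITE,
  locally finite, entirely off-line model avoiding it (sub-FOZ tails do not give finiteness abstractly).
* `rhUpTo_iff_offLine_above` — `RiemannHypothesisUpTo T` ⟺ every off-line zero of `ζ` has `|im| > T`.
* `rh_of_rhUpTo_of_locus_of_cover` — the bookkeeping direction at `ζ`.
* `etail_locus_iff_cofinite_of_cobounded` — for EVERY antitone exhausting family of exclusion regions with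
  height-bounded uncovered sets, the ∃-tail at `ζ` is `CofiniteCriticalLine` (RuelleBand crux, = FOZ).
* `exists_height_sufficient` — `∃ T, (RiemannHypothesisUpTo T → RiemannHypothesis)` is a theorem of logic (the
  vacuity trap: «some finite verification suffices» is content-free until `T` is named).
-/

set_option linter.dupNamespace false

noncomputable section

open Complex Set

namespace Summit.RiemannHypothesis.RiemannHypothesis.Theorems.Splittings.XBarrierRaw

open Literature.NumberTheory.LFunctions Literature.NumberTheory.DiophantineGeometry
open Summit.RiemannHypothesis.RiemannHypothesis.Theses.RuelleBand

/-- **Covering criterion** (raw). [folklore] -/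
theorem forall_locusSplit_iff_cover (T : ℝ) (R : Set ℂ) :
    (∀ Z : Set ℂ, (∀ s ∈ Z, (0 < s.re ∧ s.re < 1 ∧ s.re ≠ 1 / 2) → T < |s.im|) →
        (∀ s ∈ Z, (0 < s.re ∧ s.re < 1 ∧ s.re ≠ 1 / 2) → s ∉ R) →
        ∀ s ∈ Z, ¬ (0 < s.re ∧ s.re < 1 ∧ s.re ≠ 1 / 2)) ↔
      ∀ s : ℂ, (0 < s.re ∧ s.re < 1 ∧ s.re ≠ 1 / 2) → T < |s.im| → s ∈ R := by
  constructor
  · intro h s hs hT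
    by_contra hR
    have h1 : ∀ z ∈ ({s} : Set ℂ), (0 < z.re ∧ z.re < 1 ∧ z.re ≠ 1 / 2) → T < |z.im| :=
      fun z hz _ ↦ by rw [mem_singleton_iff.1 hz]; exact hT
    have h2 : ∀ z ∈ ({s} : Set ℂ), (0 < z.re ∧ z.re < 1 ∧ z.re ≠ 1 / 2) → z ∉ R :=
      fun z hz _ ↦ by rw [mem_singleton_iff.1 hz]; exact hR
    exact h {s} h1 h2 s rfl hs
  · intro h Z hF hL s hsZ hs
    exact hL s hsZ hs (h s hs (hF s hsZ hs))

/-- **Count currency is orthogonal to a finite verification** (raw): the single point `3/4 + (|T|+1)i` is a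
counter-model. [folklore] -/
theorem not_forall_countSplit (T : ℝ) :
    ¬ ∀ Z : Set ℂ, (∀ s ∈ Z, (0 < s.re ∧ s.re < 1 ∧ s.re ≠ 1 / 2) → T < |s.im|) →
        {s ∈ Z | 0 < s.re ∧ s.re < 1 ∧ s.re ≠ 1 / 2}.Subsingleton →
        ∀ s ∈ Z, ¬ (0 < s.re ∧ s.re < 1 ∧ s.re ≠ 1 / 2) := by
  intro h
  set s₀ : ℂ := ((3 / 4 : ℝ) : ℂ) + ((|T| + 1 : ℝ) : ℂ) * I with hs₀
  have hre : s₀.re = 3 / 4 := by simp [hs₀]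
  have him : s₀.im = |T| + 1 := by simp [hs₀]
  have hs : 0 < s₀.re ∧ s₀.re < 1 ∧ s₀.re ≠ 1 / 2 := by
    refine ⟨by rw [hre]; norm_num, by rw [hre]; norm_num, by rw [hre]; norm_num⟩
  have hT : T < |s₀.im| := by
    rw [him, abs_of_pos (by positivity)]
    have := le_abs_self T
    linarith
  have h1 : ∀ z ∈ ({s₀} : Set ℂ), (0 < z.re ∧ z.re < 1 ∧ z.re ≠ 1 / 2) → T < |z.im| :=
    fun z hz _ ↦ by rw [mem_singleton_iff.1 hz]; exact hT
  have h2 : {s ∈ ({s₀} : Set ℂ) | 0 < s.re ∧ s.re < 1 ∧ s.re ≠ 1 / 2}.Subsingleton :=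
    (subsingleton_singleton).anti (sep_subset _ _)
  exact h {s₀} h1 h2 s₀ rfl hs

/-- **Sub-FOZ tails give no finiteness abstractly** (raw): if `R` leaves off-line points of unbounded height
uncovered, some infinite, locally finite, entirely off-line `Z` avoids `R`. [folklore] -/
theorem exists_model_locus_infinite {R : Set ℂ}
    (hun : ∀ T : ℝ, ∃ s : ℂ, (0 < s.re ∧ s.re < 1 ∧ s.re ≠ 1 / 2) ∧ T < |s.im| ∧ s ∉ R) :
    ∃ Z : Set ℂ, (∀ T : ℝ, {s ∈ Z | |s.im| ≤ T}.Finite) ∧ (∀ s ∈ Z, s ∉ R) ∧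
      (∀ s ∈ Z, 0 < s.re ∧ s.re < 1 ∧ s.re ≠ 1 / 2) ∧ ¬ Z.Finite := by
  choose f hf using fun n : ℕ ↦ hun n
  refine ⟨range f, ?_, ?_, ?_, ?_⟩
  · intro T
    refine ((finite_Iio ⌈T⌉₊).image f).subset ?_
    rintro s ⟨⟨n, rfl⟩, hT⟩
    refine ⟨n, ?_, rfl⟩
    have h1 : (n : ℝ) < |(f n).im| := (hf n).2.1
    have h2 : T ≤ ⌈T⌉₊ := Nat.le_ceil T
    have h3 : (n : ℝ) < ⌈T⌉₊ := by linarith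
    exact_mod_cast h3
  · rintro _ ⟨n, rfl⟩; exact (hf n).2.2
  · rintro _ ⟨n, rfl⟩; exact (hf n).1
  · intro hfin
    obtain ⟨M, hM⟩ := (hfin.image fun s ↦ |s.im|).bddAbove
    have h1 : |(f ⌈M⌉₊).im| ≤ M := hM ⟨f ⌈M⌉₊, ⟨⌈M⌉₊, rfl⟩, rfl⟩
    have h2 : ((⌈M⌉₊ : ℕ) : ℝ) < |(f ⌈M⌉₊).im| := (hf ⌈M⌉₊).2.1
    have h3 : M ≤ ((⌈M⌉₊ : ℕ) : ℝ) := Nat.le_ceil M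
    linarith

/-- `RiemannHypothesisUpTo T` (zeros with `0 < im ≤ T` on the line) ⟺ every OFF-LINE zero has `|im| > T`
(conjugate zeros; no real zeros in `(0,1)`). [folklore] -/
theorem rhUpTo_iff_offLine_above (T : ℝ) :
    RiemannHypothesisUpTo T ↔
      ∀ s : ℂ, riemannZeta s = 0 → 0 < s.re → s.re < 1 → s.re ≠ 1 / 2 → T < |s.im| := by
  constructor
  · intro h s hz h0 h1 hne
    by_contra hle
    rw [not_lt] at hle
    rcases lt_trichotomy s.im 0 with him | him | him
    · exact hne (h.re_eq_of_im_neg hz him (by rw [abs_of_neg him] at hle; exact hle))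
    · exact riemannZeta_ne_zero_of_im_eq_zero_of_pos_of_lt_one him h0 h1 hz
    · exact hne (h s hz him (by rw [abs_of_pos him] at hle; exact hle))
  · intro h s hz h0 hT
    by_contra hne
    have hstrip := re_mem_Ioo_of_riemannZeta_eq_zero_of_im_ne_zero hz h0.ne'
    have := h s hz hstrip.1 hstrip.2 hne
    rw [abs_of_pos h0] at this
    linarith

/-- The bookkeeping direction at `ζ`: a COVERING pair (finite verification to `T`, no off-line zero in a region
containing every off-line point above `T`) gives RH. [folklore] -/
theorem rh_of_rhUpTo_of_locus_of_cover {T : ℝ} {R : Set ℂ}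
    (hco : ∀ s : ℂ, (0 < s.re ∧ s.re < 1 ∧ s.re ≠ 1 / 2) → T < |s.im| → s ∈ R)
    (hF : RiemannHypothesisUpTo T)
    (hL : ∀ s : ℂ, riemannZeta s = 0 → 0 < s.re → s.re < 1 → s ∈ R → s.re = 1 / 2) :
    _root_.RiemannHypothesis := by
  rw [show _root_.RiemannHypothesis ↔ RiemannHypothesisStrip from riemannHypothesis_iff_strip_holds]
  intro s hz h0 h1
  by_contra hne
  exact hne (hL s hz h0 h1 (hco s ⟨h0, h1, hne⟩ ((rhUpTo_iff_offLine_above T).1 hF s hz h0 h1 hne)))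

/-- **Every co-bounded exclusion family has the ∃-tail FOZ** (raw): for an antitone family `R : ℝ → Set ℂ`
exhausting the off-line strip whose uncovered sets are height-bounded, «no off-line zero of `ζ` in `R H` for SOME
`H`» ⟺ `CofiniteCriticalLine`. [folklore] -/
theorem etail_locus_iff_cofinite_of_cobounded {R : ℝ → Set ℂ} (hanti : Antitone R)
    (hexh : ∀ s : ℂ, (0 < s.re ∧ s.re < 1 ∧ s.re ≠ 1 / 2) → ∃ H, s ∉ R H)
    (hco : ∀ H : ℝ, ∃ T : ℝ, ∀ s : ℂ, (0 < s.re ∧ s.re < 1 ∧ s.re ≠ 1 / 2) → T < |s.im| → s ∈ R H) :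
    (∃ H : ℝ, ∀ s : ℂ, riemannZeta s = 0 → 0 < s.re → s.re < 1 → s ∈ R H → s.re = 1 / 2) ↔
      CofiniteCriticalLine := by
  classical
  constructor
  · rintro ⟨H, hH⟩
    obtain ⟨T, hT⟩ := hco H
    -- the off-line zeros lie in the compact box [0,1] × [-T, T]
    refine (((isCompact_Icc (a := (0 : ℝ)) (b := 1)).reProdIm
      (isCompact_Icc (a := -T) (b := T))).inter_riemannZetaZeros_finite).subset ?_
    rintro s ⟨hz, h0, h1, hne⟩
    refine ⟨Complex.mem_reProdIm.2 ⟨⟨h0.le, h1.le⟩, abs_le.1 ?_⟩, hz⟩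
    by_contra hlt
    exact hne (hH s hz h0 h1 (hT s ⟨h0, h1, hne⟩ (lt_of_not_ge hlt)))
  · intro hfin
    have hc : ∀ s ∈ {s : ℂ | riemannZeta s = 0 ∧ 0 < s.re ∧ s.re < 1 ∧ s.re ≠ 1 / 2}, ∃ H, s ∉ R H :=
      fun s hs ↦ hexh s hs.2
    choose! Hf hHf using hc
    obtain ⟨H0, hH0⟩ := (hfin.image Hf).bddAbove
    refine ⟨H0, fun s hz h0 h1 hR ↦ ?_⟩
    by_contra hne
    have hmem : s ∈ {s : ℂ | riemannZeta s = 0 ∧ 0 < s.re ∧ s.re < 1 ∧ s.re ≠ 1 / 2} := ⟨hz, h0, h1, hne⟩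
    have hle : Hf s ≤ H0 := hH0 ⟨s, hmem, rfl⟩
    exact hHf s hmem (hanti hle hR)

/-- **The vacuity trap, pure form**: SOME finite verification suffices for RH — a theorem of logic (excluded
middle; under `¬RH` take the height of an off-line zero). [folklore] -/
theorem exists_height_sufficient : ∃ T : ℝ, (RiemannHypothesisUpTo T → _root_.RiemannHypothesis) := by
  by_cases hRH : _root_.RiemannHypothesis
  · exact ⟨0, fun _ ↦ hRH⟩
  · have hS : ¬ RiemannHypothesisStrip := fun h ↦ hRH (riemannHypothesis_iff_strip_holds.2 h)
    simp only [RiemannHypothesisStrip, not_forall] at hS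
    obtain ⟨s, hz, h0, h1, hne⟩ := hS
    refine ⟨|s.im|, fun hF ↦ absurd ?_ hne⟩
    rcases lt_trichotomy s.im 0 with him | him | him
    · exact hF.re_eq_of_im_neg hz him (by rw [abs_of_neg him])
    · exact absurd hz (riemannZeta_ne_zero_of_im_eq_zero_of_pos_of_lt_one him h0 h1)
    · exact hF s hz him (by rw [abs_of_pos him])

end Summit.RiemannHypothesis.RiemannHypothesis.Theorems.Splittings.XBarrierRaw

end
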